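/-
Copyright (c) 2026. All rights reserved.
Released under Apache 2.0 license as described in the file LICENSE.
Authors: abc-iut cell, wave-4 seat abc-iut-w4-d059 (proof-only; generic tree-system combinatorics: the two
end-vertex systems of a compatible system of closed tree edges).
-/
import Literature.AnabelianGeometry.SemiGraphs.TreeSystemFixedPair
import Literature.AnabelianGeometry.SemiGraphs.TreeSystemFixedClosedEdges
import HarnessLib

/-!
# [SemiAnbd] Thm 3.7 (iii) / Thm 5.4 (i): end systems of a compatible system of tree edges (proof-only)

Mochizuki, *Semi-graphs of anabelioids*, Publ. RIMS **42** (2006), proof of Thm 3.7 (iii) p. 41 with the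
author's Comments (6)(b) ("for `i ≥ j` we have natural maps `V_i → V_j`, `E_i → E_j`"; a compatible system
of closed edges of the universal graph-coverings `T_j`), reused "entirely similarly" in the proof of
Thm 5.4 (i) p. 66. [cite: MochizukiSemiAnbd2006, Thm 3.7(iii) p.41]

PROOF-ONLY, GENERIC file (abc-iut cell, sub-DAG `plan/L3/SUBDAG-SemiAnbd-Thm54.md`, row T54-0b (AI3)
edge twin, seat abc-iut-w4-d059): in a directed system of trees ALL OF WHOSE EDGES ARE CLOSED (the trees
are graphs: universal graph-coverings of the finite levels of a graph of anabelioids) with functorial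
transition morphisms, an eventual compatible system of edges `ε_j`, `j ≥ j₁`, carries two compatible
branch systems and two compatible end-vertex systems defined at ALL levels and level-wise distinct from
`j₁` on (`exists_ends_of_compatible_edges`) — exactly the end-point data recorded by the field `edgeFix`
of abc-iut-w4-d053's `ArithLevelData`; tool `exists_unique_branch_over` (a morphism of semi-graphs is a
bijection on the branches of each edge).  No definition; nothing specific to anabelioids; nothing here
takes a side on [IUTchIII] Cor. 3.12.
-/

namespace Literature.AnabelianGeometry.SemiGraphs

open CategoryTheory

universe v u

/-! ### End-point data of a compatible system of closed tree edges -/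

section Generic

variable {J : Type v} [Preorder J] (T : J → SemiGraph.{u}) (f : ∀ ⦃i j : J⦄, i ≤ j → (T j ⟶ T i))

omit [Preorder J] in
/-- Over a morphism of semi-graphs, every branch of the image edge has exactly one branch of the edge
above it (a morphism is a bijection on the branches of each edge, §1 p. 11).
[cite: MochizukiSemiAnbd2006, §1 p.11] -/
theorem exists_unique_branch_over {G G' : SemiGraph.{u}} (φ : G ⟶ G') {e : G.Edge} {b' : G'.Branch}
    (hb' : G'.edgeOf b' = φ.edgeMap e) :
    ∃ d : G.Branch, (G.edgeOf d = e ∧ φ.branchMap d = b') ∧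
      ∀ d' : G.Branch, G.edgeOf d' = e → φ.branchMap d' = b' → d' = d := by
  obtain ⟨d₁, d₂, h12, h1e, h2e, -⟩ := G.two_branches e
  have hφ1 : G'.edgeOf (φ.branchMap d₁) = φ.edgeMap e := by rw [φ.edgeOf_branchMap, h1e]
  have hφ2 : G'.edgeOf (φ.branchMap d₂) = φ.edgeMap e := by rw [φ.edgeOf_branchMap, h2e]
  have hne : φ.branchMap d₁ ≠ φ.branchMap d₂ := fun h => h12 (φ.branchMap_injOn d₁ d₂ (h1e.trans h2e.symm) h)
  have huniq : ∀ d d' : G.Branch, G.edgeOf d = e → G.edgeOf d' = e → φ.branchMap d' = φ.branchMap d → d' = d :=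
    fun d d' hd hd' h => φ.branchMap_injOn d' d (hd'.trans hd.symm) h
  by_cases h : φ.branchMap d₁ = b'
  · exact ⟨d₁, ⟨h1e, h⟩, fun d' hd' hb => huniq d₁ d' h1e hd' (hb.trans h.symm)⟩
  · have h2 : φ.branchMap d₂ = b' :=
      (SemiGraph.branch_eq_of_ne_of_ne hφ1 hφ2 hb' (Ne.symm hne) (Ne.symm h)).symm ▸ rfl
    exact ⟨d₂, ⟨h2e, h2⟩, fun d' hd' hb => huniq d₂ d' h2e hd' (hb.trans h2.symm)⟩

/-- **End-point data of a compatible edge system**: in a directed system of trees all of whose edges are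
closed (universal graph-coverings of the finite levels of a GRAPH of anabelioids), with functorial
transition morphisms, an eventual compatible system of edges `ε_j` (`j ≥ j₁`) carries two compatible
branch systems `c_j`, `c'_j` and two compatible END-VERTEX systems `x₁`, `x₂` (defined at ALL levels),
level-wise distinct from `j₁` on — the shape of the field `edgeFix` of abc-iut-w4-d053's `ArithLevelData`.
[cite: MochizukiSemiAnbd2006, Thm 5.4 (i), p. 66] -/
theorem exists_ends_of_compatible_edges [IsDirectedOrder J] (hT : ∀ j, (T j).IsTree)
    (hTg : ∀ j, (T j).IsGraph)
    (f_comp : ∀ ⦃i j k : J⦄ (hij : i ≤ j) (hjk : j ≤ k), f hjk ≫ f hij = f (hij.trans hjk))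
    {j₁ : J} (ε : ∀ j : {j : J // j₁ ≤ j}, (T j.1).Edge)
    (hε : ∀ ⦃i j : {j : J // j₁ ≤ j}⦄ (h : i.1 ≤ j.1), (f h).edgeMap (ε j) = ε i) :
    ∃ (c c' : ∀ j : {j : J // j₁ ≤ j}, (T j.1).Branch) (x₁ x₂ : ∀ j, (T j).Vertex),
      (∀ ⦃i j : J⦄ (h : i ≤ j), (f h).vertexMap (x₁ j) = x₁ i) ∧
      (∀ ⦃i j : J⦄ (h : i ≤ j), (f h).vertexMap (x₂ j) = x₂ i) ∧
      ∀ j : {j : J // j₁ ≤ j}, x₁ j.1 ≠ x₂ j.1 ∧ (T j.1).edgeOf (c j) = ε j ∧ (T j.1).edgeOf (c' j) = ε j ∧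
        (T j.1).abuts (c j) = some (x₁ j.1) ∧ (T j.1).abuts (c' j) = some (x₂ j.1) := by
  classical
  -- pointwise functoriality
  have f_comp_v : ∀ ⦃i j k : J⦄ (hij : i ≤ j) (hjk : j ≤ k) (z : (T k).Vertex),
      (f hij).vertexMap ((f hjk).vertexMap z) = (f (hij.trans hjk)).vertexMap z := by
    intro i j k hij hjk z
    rw [← f_comp hij hjk, SemiGraph.comp_vertexMap, Function.comp_apply]
  have f_comp_b : ∀ ⦃i j k : J⦄ (hij : i ≤ j) (hjk : j ≤ k) (b : (T k).Branch),
      (f hij).branchMap ((f hjk).branchMap b) = (f (hij.trans hjk)).branchMap b := by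
    intro i j k hij hjk b
    rw [← f_comp hij hjk, SemiGraph.comp_branchMap, Function.comp_apply]
  -- the two branches of the base edge
  set j₀ : {j : J // j₁ ≤ j} := ⟨j₁, le_rfl⟩ with hj₀
  obtain ⟨b₁, b₂, hb12, hb1e, hb2e, -⟩ := (T j₁).two_branches (ε j₀)
  -- the branch systems over `b₁`, `b₂`
  have hover : ∀ (j : {j : J // j₁ ≤ j}) (b₀ : (T j₁).Branch), (T j₁).edgeOf b₀ = ε j₀ →
      (T j₁).edgeOf b₀ = (f j.2).edgeMap (ε j) := fun j b₀ hb₀ => by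
    rw [hb₀]; exact (hε (i := j₀) (j := j) j.2).symm
  choose cs hcs hcs_uniq using fun (j : {j : J // j₁ ≤ j}) (b₀ : (T j₁).Branch)
    (hb₀ : (T j₁).edgeOf b₀ = ε j₀) => exists_unique_branch_over (f j.2) (hover j b₀ hb₀)
  let c : ∀ j : {j : J // j₁ ≤ j}, (T j.1).Branch := fun j => cs j b₁ hb1e
  let c' : ∀ j : {j : J // j₁ ≤ j}, (T j.1).Branch := fun j => cs j b₂ hb2e
  have hce : ∀ j, (T j.1).edgeOf (c j) = ε j := fun j => (hcs j b₁ hb1e).1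
  have hc'e : ∀ j, (T j.1).edgeOf (c' j) = ε j := fun j => (hcs j b₂ hb2e).1
  have hcb : ∀ j, (f j.2).branchMap (c j) = b₁ := fun j => (hcs j b₁ hb1e).2
  have hc'b : ∀ j, (f j.2).branchMap (c' j) = b₂ := fun j => (hcs j b₂ hb2e).2
  have hcc : ∀ j, c j ≠ c' j := fun j h => hb12 (by rw [← hcb j, ← hc'b j, h])
  -- compatibility of the branch systems
  have hc_comp : ∀ ⦃i j : {j : J // j₁ ≤ j}⦄ (h : i.1 ≤ j.1), (f h).branchMap (c j) = c i := by
    intro i j h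
    refine hcs_uniq i b₁ hb1e _ ?_ ?_
    · rw [(f h).edgeOf_branchMap, hce j, hε h]
    · rw [f_comp_b i.2 h (c j)]; exact hcb j
  have hc'_comp : ∀ ⦃i j : {j : J // j₁ ≤ j}⦄ (h : i.1 ≤ j.1), (f h).branchMap (c' j) = c' i := by
    intro i j h
    refine hcs_uniq i b₂ hb2e _ ?_ ?_
    · rw [(f h).edgeOf_branchMap, hc'e j, hε h]
    · rw [f_comp_b i.2 h (c' j)]; exact hc'b j
  -- the end-vertices at levels `≥ j₁` (all edges are closed)
  have hav : ∀ (j : {j : J // j₁ ≤ j}) (b : (T j.1).Branch), ∃ w, (T j.1).abuts b = some w :=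
    fun j b => Option.isSome_iff_exists.mp ((hTg j.1).abuts_isSome b)
  choose av hav using hav
  let a : ∀ j : {j : J // j₁ ≤ j}, (T j.1).Vertex := fun j => av j (c j)
  let a' : ∀ j : {j : J // j₁ ≤ j}, (T j.1).Vertex := fun j => av j (c' j)
  have hca : ∀ j, (T j.1).abuts (c j) = some (a j) := fun j => hav j (c j)
  have hc'a : ∀ j, (T j.1).abuts (c' j) = some (a' j) := fun j => hav j (c' j)
  have haa : ∀ j, a j ≠ a' j := by
    intro j h
    exact hcc j (SemiGraph.branch_unique_of_isAcyclic (hT j.1).isTree.isAcyclic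
      ((hce j).trans (hc'e j).symm) (hca j) (by rw [h]; exact hc'a j))
  -- compatibility of the end-vertices at levels `≥ j₁`
  have ha_comp : ∀ ⦃i j : {j : J // j₁ ≤ j}⦄ (h : i.1 ≤ j.1), (f h).vertexMap (a j) = a i := by
    intro i j h
    have := (f h).abuts_branchMap (c j) (a j) (hca j)
    rw [hc_comp h, hca i] at this
    exact (Option.some.inj this).symm
  have ha'_comp : ∀ ⦃i j : {j : J // j₁ ≤ j}⦄ (h : i.1 ≤ j.1), (f h).vertexMap (a' j) = a' i := by
    intro i j h
    have := (f h).abuts_branchMap (c' j) (a' j) (hc'a j)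
    rw [hc'_comp h, hc'a i] at this
    exact (Option.some.inj this).symm
  -- extension to all levels along the directed order
  have hK : ∀ i : J, ∃ k, j₁ ≤ k ∧ i ≤ k := fun i => exists_ge_ge j₁ i
  choose K hK₁ hK₂ using hK
  have extend : ∀ (s : ∀ j : {j : J // j₁ ≤ j}, (T j.1).Vertex),
      (∀ ⦃i j : {j : J // j₁ ≤ j}⦄ (h : i.1 ≤ j.1), (f h).vertexMap (s j) = s i) →
      ∃ x : ∀ j, (T j).Vertex, (∀ ⦃i j : J⦄ (h : i ≤ j), (f h).vertexMap (x j) = x i) ∧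
        ∀ j : {j : J // j₁ ≤ j}, x j.1 = s j := by
    intro s hs
    refine ⟨fun i => (f (hK₂ i)).vertexMap (s ⟨K i, hK₁ i⟩), fun i i' h => ?_, fun j => ?_⟩
    · obtain ⟨m, hm, hm'⟩ := exists_ge_ge (K i) (K i')
      have e1 : s ⟨K i, hK₁ i⟩ = (f hm).vertexMap (s ⟨m, (hK₁ i).trans hm⟩) :=
        (hs (i := ⟨K i, hK₁ i⟩) (j := ⟨m, (hK₁ i).trans hm⟩) hm).symm
      have e2 : s ⟨K i', hK₁ i'⟩ = (f hm').vertexMap (s ⟨m, (hK₁ i).trans hm⟩) :=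
        (hs (i := ⟨K i', hK₁ i'⟩) (j := ⟨m, (hK₁ i).trans hm⟩) hm').symm
      change (f h).vertexMap ((f (hK₂ i')).vertexMap (s ⟨K i', hK₁ i'⟩)) =
        (f (hK₂ i)).vertexMap (s ⟨K i, hK₁ i⟩)
      rw [e1, e2, f_comp_v, f_comp_v, f_comp_v]
    · change (f (hK₂ j.1)).vertexMap (s ⟨K j.1, hK₁ j.1⟩) = s j
      exact hs (i := j) (j := ⟨K j.1, hK₁ j.1⟩) (hK₂ j.1)
  obtain ⟨x₁, hx₁, hx₁a⟩ := extend a ha_comp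
  obtain ⟨x₂, hx₂, hx₂a⟩ := extend a' ha'_comp
  refine ⟨c, c', x₁, x₂, hx₁, hx₂, fun j => ⟨?_, hce j, hc'e j, ?_, ?_⟩⟩
  · rw [hx₁a j, hx₂a j]; exact haa j
  · rw [hx₁a j]; exact hca j
  · rw [hx₂a j]; exact hc'a j

end Generic

end Literature.AnabelianGeometry.SemiGraphs
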